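import Summits.AtomisticToContinuum.FouriersLaw.Theorems.BondHeatUncertaintyExtensiveSnapshotIrreversibilityTapDualityOddCorrectorAux2

/-!
# Tap duality for the odd Kubo corrector (stub S_A of line tap-duality-gk-time)

Helper file `--supports stmt-AtomisticToContinuum-9121`
(`BondHeatUncertainty.ExtensiveSnapshotIrreversibility`), stub `stub_tapDualityOddCorrector` of the
line `tap-duality-gk-time`, part III (part I `…TapDualityOddCorrectorAux1`: smooth Poisson solutions
for decaying sources and forecast pairings; part II `…Aux2`: the duality inequality in density form).

For the pinned anharmonic chain `P = pinnedChain ω₂ lam β γ` (all parameters `> 0`), `N ≥ 2`,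
`T > 0`, the total current `J = Σ_i j_i`, the normalised Gibbs measure `μ_T`, ANY `μ_T`-a.e. limit
`u` of the finite-horizon Kubo correctors `∫₀^τ P_t J dt`, its odd part `uo = ½(u − u∘Θ)` under the
momentum flip `Θ(q,p) = (q,−p)`, and the forecasts `Puo t z = ∫ uo dP_t(z,·)`:

  `t ↦ ∫ uo · Puo t dμ_T` is integrable on `(0,∞)` and
  `(∫ uo² dμ_T)² ≤ ⟨u, J⟩_{μ_T} · ∫₀^∞ ∫ uo · Puo t dμ_T dt`        (`stub_tapDualityOddCorrector`).

Proof. Part II proves both conjuncts, against the unnormalised weight `ρ = e^{-H/T}`, for the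
smooth corrector `u₀` of `corrector_smooth` (`L u₀ = -J`, `|u₀| ≤ K e^{ϑH}`) and its odd part `uo₀`
(`tapDuality_density`); both sides are homogeneous of degree two, so dividing by `Z² = (∫ ρ)²`
gives the `μ_T`-form. TRANSFER to `u`: the finite-horizon correctors converge everywhere to
`u⋆ = ∫₀^∞ P_t J dt =ᵐ u₀` (`corrector_exists`, `corrector_smooth`), so `u = u₀` `μ_T`-a.e.;
`μ_T ∼ dx` and `Θ` preserves `dx`, so `uo = uo₀` `μ_T`-a.e.; and `μ_T` is invariant for the kernels
(`pinnedChain_gibbsMeasure_bind_transitionKernel`), so for every `t` the forecasts `Puo t` and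
`P_t uo₀` agree `μ_T`-a.e. — hence all four integrals are those of `u₀`.

References: Kundu–Dhar–Narayan 2009 (the corrector); Cuneo–Eckmann–Hairer–Rey-Bellet 2018 §3.1;
folklore.
-/

noncomputable section

namespace Summit.AtomisticToContinuum.FouriersLaw.Theorems.ExtensiveSnapshotIrreversibility.TapDuality

open MeasureTheory Filter Topology
open scoped ENNReal NNReal ContDiff
open Literature.MathematicalPhysics.KineticTheory.HeatConduction
open Summit.AtomisticToContinuum.FouriersLaw.Theorems.OddSectorIrreversibility.Corrector
open Summit.AtomisticToContinuum.FouriersLaw.Theorems.SubdiffusiveBondHeat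

variable {N : ℕ}

/-- **Tap duality for any a.e. version of the Kubo corrector.** For the pinned chain (all
parameters `> 0`), `N ≥ 1`, `T > 0`, `μ_T` the normalised Gibbs measure, `J` the total current,
`u` any `μ_T`-a.e. limit of the finite-horizon Kubo correctors, `uo = ½(u − u∘Θ)` and
`Puo t z = ∫ uo dP_t(z,·)`: `t ↦ ∫ uo · Puo t dμ_T` is integrable on `(0,∞)` and
`(∫ uo² dμ_T)² ≤ (∫ u J dμ_T) · ∫_{(0,∞)} ∫ uo · Puo t dμ_T dt`. Density form for the smooth
corrector (`tapDuality_density`), normalisation by `Z = ∫ e^{-H/T}`, and transfer along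
`u = u₀` a.e. (uniqueness of limits), `uo = uo₀` a.e. (`Θ` preserves `dx ∼ μ_T`) and
`Puo t = P_t uo₀` a.e. (invariance of `μ_T` under the kernels). [folklore] -/
theorem tapDuality_gibbsMeasure {ω₂ lam β γ : ℝ} (hω : 0 < ω₂) (hl : 0 < lam) (hβ : 0 < β)
    (hγ : 0 < γ) {T : ℝ} (hT : 0 < T) (hN : 0 < N) {u uo : PhaseSpace N → ℝ}
    {Puo : ℝ → PhaseSpace N → ℝ}
    (hlim : ∀ᵐ x ∂((pinnedChain ω₂ lam β γ).gibbsMeasure N T),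
      Tendsto (fun τ : ℝ => ∫ t in Set.Ioc (0 : ℝ) τ,
        (∫ y, (∑ i : Fin N, (pinnedChain ω₂ lam β γ).bondCurrent N i y)
          ∂((pinnedChain ω₂ lam β γ).transitionKernel N T T t.toNNReal x))) atTop (𝓝 (u x)))
    (huo : uo = fun x => (u x - u (x.1, -x.2)) / 2)
    (hPuo : Puo = fun t z => ∫ y, uo y ∂((pinnedChain ω₂ lam β γ).transitionKernel N T T t.toNNReal z)) :
    IntegrableOn (fun t : ℝ => ∫ z, uo z * Puo t z ∂((pinnedChain ω₂ lam β γ).gibbsMeasure N T))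
        (Set.Ioi 0) ∧
      (∫ z, (uo z) ^ 2 ∂((pinnedChain ω₂ lam β γ).gibbsMeasure N T)) ^ 2 ≤
        (∫ z, u z * (∑ i : Fin N, (pinnedChain ω₂ lam β γ).bondCurrent N i z)
            ∂((pinnedChain ω₂ lam β γ).gibbsMeasure N T)) *
          ∫ t in Set.Ioi (0 : ℝ), ∫ z, uo z * Puo t z
            ∂((pinnedChain ω₂ lam β γ).gibbsMeasure N T) := by
  set P := pinnedChain ω₂ lam β γ with hP
  set μT := P.gibbsMeasure N T with hμT
  set ρ := P.gibbsDensity N T with hρ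
  set J : PhaseSpace N → ℝ := fun x => ∑ i : Fin N, P.bondCurrent N i x with hJ
  -- the smooth corrector `u₀` and the everywhere-defined corrector `u⋆ =ᵐ u₀`
  obtain ⟨u₀, hus, hae, hpde, hgrowth⟩ := corrector_smooth hω hl hβ hγ hT hN
  have hϑ : 0 < 1 / (4 * T) := by positivity
  have h1ϑ : 1 / (4 * T) < 1 / T := by
    rw [div_lt_div_iff₀ (by positivity) hT]; nlinarith
  have h2ϑ : 2 * (1 / (4 * T)) < 1 / T := by
    rw [show 2 * (1 / (4 * T)) = 1 / (2 * T) by field_simp; ring, div_lt_div_iff₀ (by positivity) hT]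
    nlinarith
  obtain ⟨K, c, -, -, -, -, -, -, hpt, -, -, -⟩ := corrector_exists hω hl hβ hγ hT hN hϑ h2ϑ
    (fun s z => ∫ y, J y ∂(P.transitionKernel N T T s.toNNReal z)) rfl
    (fun z => ∫ s in Set.Ioi (0 : ℝ), ∫ y, J y ∂(P.transitionKernel N T T s.toNNReal z)) rfl
  obtain ⟨K₁, -, huK⟩ := hgrowth (1 / (4 * T)) hϑ h1ϑ
  -- `u = u₀` `μ_T`-a.e.
  have hae' : (fun x => ∫ t in Set.Ioi (0 : ℝ), ∫ y, J y
      ∂(P.transitionKernel N T T t.toNNReal x)) =ᵐ[μT] u₀ :=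
    (P.gibbsMeasure_absolutelyContinuous N T).ae_eq hae
  have huu₀ : u =ᵐ[μT] u₀ := by
    filter_upwards [hlim, hae'] with x hx hx'
    rw [← hx']
    exact tendsto_nhds_unique hx (hpt x)
  -- the smooth odd part `uo₀`; `uo = uo₀` `μ_T`-a.e. (`Θ` preserves `dx`, `dx ∼ μ_T`)
  set uo₀ : PhaseSpace N → ℝ := fun x => (u₀ x - u₀ (x.1, -x.2)) / 2 with huo₀
  have hvol : (volume : Measure (PhaseSpace N)) ≪ μT :=
    absolutelyContinuous_tilted (pinnedChain_integrable_gibbsDensity hω hl.le hβ.le γ N hT)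
  have hflip : (fun x => u (x.1, -x.2)) =ᵐ[μT] fun x => u₀ (x.1, -x.2) := by
    have h1 : u =ᵐ[volume] u₀ := hvol.ae_eq huu₀
    have h2 := (P.gibbsMeasure_absolutelyContinuous N T).ae_eq
      ((measurePreserving_momentumReversal N).quasiMeasurePreserving.ae_eq_comp h1)
    filter_upwards [h2] with x hx
    simpa using hx
  have huo_ae : uo =ᵐ[μT] uo₀ := by
    filter_upwards [huu₀, hflip] with x hx hx'
    rw [huo, huo₀]
    show (u x - u (x.1, -x.2)) / 2 = (u₀ x - u₀ (x.1, -x.2)) / 2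
    rw [hx, hx']
  -- the forecasts: `Puo t = P_t uo₀` `μ_T`-a.e. for every `t` (invariance of `μ_T`)
  set Puo₀ : ℝ → PhaseSpace N → ℝ := fun t z =>
    ∫ y, uo₀ y ∂(P.transitionKernel N T T t.toNNReal z) with hPuo₀
  have hPuo_ae : ∀ t : ℝ, (fun z => Puo t z) =ᵐ[μT] fun z => Puo₀ t z := by
    intro t
    have hinv : μT.bind (P.transitionKernel N T T t.toNNReal) = μT :=
      pinnedChain_gibbsMeasure_bind_transitionKernel hω hl.le hβ.le hγ.le hN hT t.toNNReal
    have h1 : ∀ᵐ y ∂(μT.bind (P.transitionKernel N T T t.toNNReal)), uo y = uo₀ y := by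
      rw [hinv]; exact huo_ae
    filter_upwards [Measure.ae_ae_of_ae_comp h1] with z hz
    rw [hPuo]
    exact integral_congr_ae hz
  -- all four integrals are those of `u₀`
  have hGK : (fun t : ℝ => ∫ z, uo z * Puo t z ∂μT) = fun t => ∫ z, uo₀ z * Puo₀ t z ∂μT := by
    funext t
    refine integral_congr_ae ?_
    filter_upwards [huo_ae, hPuo_ae t] with z hz hz'
    rw [hz]
    exact congrArg (fun r => uo₀ z * r) hz'
  have hI : ∫ z, uo z ^ 2 ∂μT = ∫ z, uo₀ z ^ 2 ∂μT :=
    integral_congr_ae (by filter_upwards [huo_ae] with z hz; rw [hz])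
  have hA : ∫ z, u z * J z ∂μT = ∫ z, u₀ z * J z ∂μT :=
    integral_congr_ae (by filter_upwards [huu₀] with z hz; rw [hz])
  rw [hGK, hI, hA]
  -- the density form for the smooth corrector, normalised by `Z = ∫ ρ`
  obtain ⟨hint, hineq⟩ := tapDuality_density hω hl hβ hγ hT hN hϑ h2ϑ hus hpde huK huo₀
  set Z := ∫ x, ρ x with hZdef
  have hZ : 0 < Z := integral_exp_pos (pinnedChain_integrable_gibbsDensity hω hl.le hβ.le γ N hT)
  have hnorm : ∀ f : PhaseSpace N → ℝ, ∫ z, f z ∂μT = Z⁻¹ * ∫ z, f z * ρ z :=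
    fun f => P.integral_gibbsMeasure f
  have hGK₀ : (fun t : ℝ => ∫ z, uo₀ z * Puo₀ t z ∂μT) = fun t => Z⁻¹ * ∫ z, uo₀ z *
      (∫ y, uo₀ y ∂(P.transitionKernel N T T t.toNNReal z)) * ρ z := by
    funext t
    rw [hnorm]
  rw [hGK₀, hnorm (fun z => uo₀ z ^ 2), hnorm (fun z => u₀ z * J z), integral_const_mul]
  refine ⟨hint.const_mul _, ?_⟩
  calc (Z⁻¹ * ∫ z, uo₀ z ^ 2 * ρ z) ^ 2 = Z⁻¹ ^ 2 * (∫ z, uo₀ z ^ 2 * ρ z) ^ 2 := by ring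
    _ ≤ Z⁻¹ ^ 2 * ((∫ z, u₀ z * J z * ρ z) * ∫ t in Set.Ioi (0 : ℝ), ∫ z, uo₀ z *
          (∫ y, uo₀ y ∂(P.transitionKernel N T T t.toNNReal z)) * ρ z) :=
        mul_le_mul_of_nonneg_left hineq (sq_nonneg _)
    _ = _ := by ring

/-- **S_A `stub_tapDualityOddCorrector`** (registered stub of line tap-duality-gk-time, verbatim):
TAP DUALITY for the odd part `uo = ½(u − u∘Θ)` of ANY `μ_T`-a.e. limit `u` of the finite-horizon
Kubo correctors of the total current `J` (`N ≥ 2`): the Green–Kubo integrand `t ↦ ⟨uo, P_t uo⟩_{μ_T}`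
is integrable on `(0,∞)` and `‖uo‖⁴_{L²(μ_T)} ≤ ⟨u, J⟩_{μ_T} · ∫₀^∞ ⟨uo, P_t uo⟩_{μ_T} dt`.
[folklore] -/
theorem stub_tapDualityOddCorrector :
    ∀ ω₂ lam β γ : ℝ, 0 < ω₂ → 0 < lam → 0 < β → 0 < γ → ∀ T : ℝ, 0 < T →
      ∀ (N : ℕ) (u : PhaseSpace N → ℝ), 2 ≤ N →
        MemLp u 2 ((pinnedChain ω₂ lam β γ).gibbsMeasure N T) →
        (∀ᵐ x ∂((pinnedChain ω₂ lam β γ).gibbsMeasure N T),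
          Tendsto (fun τ : ℝ => ∫ t in Set.Ioc (0 : ℝ) τ,
            (∫ y, (∑ i : Fin N, (pinnedChain ω₂ lam β γ).bondCurrent N i y)
              ∂((pinnedChain ω₂ lam β γ).transitionKernel N T T t.toNNReal x))) atTop (𝓝 (u x))) →
        IntegrableOn (fun t : ℝ => ∫ z, (u z - u (z.1, -z.2)) / 2 *
              (∫ y, (u y - u (y.1, -y.2)) / 2
                ∂((pinnedChain ω₂ lam β γ).transitionKernel N T T t.toNNReal z))
              ∂((pinnedChain ω₂ lam β γ).gibbsMeasure N T)) (Set.Ioi 0) ∧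
        (∫ z, ((u z - u (z.1, -z.2)) / 2) ^ 2 ∂((pinnedChain ω₂ lam β γ).gibbsMeasure N T)) ^ 2 ≤
          (∫ z, u z * (∑ i : Fin N, (pinnedChain ω₂ lam β γ).bondCurrent N i z)
              ∂((pinnedChain ω₂ lam β γ).gibbsMeasure N T)) *
            ∫ t in Set.Ioi (0 : ℝ), ∫ z, (u z - u (z.1, -z.2)) / 2 *
              (∫ y, (u y - u (y.1, -y.2)) / 2
                ∂((pinnedChain ω₂ lam β γ).transitionKernel N T T t.toNNReal z))
              ∂((pinnedChain ω₂ lam β γ).gibbsMeasure N T) := by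
  intro ω₂ lam β γ hω hl hβ hγ T hT N u hN _hu hlim
  exact tapDuality_gibbsMeasure hω hl hβ hγ hT (by omega) hlim
    (uo := fun x => (u x - u (x.1, -x.2)) / 2) rfl
    (Puo := fun t z => ∫ y, (u y - u (y.1, -y.2)) / 2
      ∂((pinnedChain ω₂ lam β γ).transitionKernel N T T t.toNNReal z)) rfl

end Summit.AtomisticToContinuum.FouriersLaw.Theorems.ExtensiveSnapshotIrreversibility.TapDuality

end
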